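/-
Copyright (c) 2026 the pub-hodgecm-mathlib formalisation cell (harness21).  Prover seat hodgecm-mathlib-K2Liu-p08 (g2), Track B «K2-LIT»,
#184♮ = hLiu418 = `stmt-HodgeConjecture-24832`; LEAD F0P6-plan (g12) RULING «M-156n» (3) 2026-09-04T08:09:40Z + «=» 08:12:06Z (G7-B), K2E5-plan (g6)
«=» 08:12:41Z; census `K2/K2Liu-p08/g2/CENSUS-G7G8-HeightVsIwasawa.K2Liu-p08-g2.md`.  File G7-B of the «HEIGHT-vs-IWASAWA» organ.
-/
import Summits.HodgeConjecture.HodgeConjecture.Theorems.K2LiuLatticeExpDecaySumBound      -- ★ G7-A: `posDef_two_entries` (2×2 bookkeeping)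
import Literature.NumberTheory.Automorphic.GodementJacquetSingularMajorant                  -- ★ `archHeight_le_adelicHeightGL`
import Literature.NumberTheory.Automorphic.UnitaryGroupAdelicProduct                        -- ★ `archPart`, `coe_archPart`
import Literature.NumberTheory.Automorphic.UnitaryGroupArchimedeanPlaces                     -- ★ `archAt`, `coe_archAt_apply`
import Mathlib.LinearAlgebra.Matrix.SchurComplement
import Mathlib.LinearAlgebra.Matrix.AbsoluteValue
import Mathlib.Algebra.Order.Chebyshev
import HarnessLib

/-!
# Crux `HLiu418`, Road Φ, gap G7-B: ARCHIMEDEAN ENTRIES AND IWASAWA BLOCKS AGAINST THE ADELIC HEIGHT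

Cell `hodgecm-mathlib`, crux item hLiu418 = `stmt-HodgeConjecture-24832`; LEAD F0P6-plan (g12) (M-156n (3)), co-dealer K2E5-plan (g6).  THEOREMS ONLY (no `def`,
no instance, no notation, no named-fact hypothesis, no `sorry`); lane `--supports stmt-HodgeConjecture-24832 --as helper` (count-neutral).
Consumer: G7-C `K2LiuIwasawaHeightLatticeSumBound` (the face Φ9-CORE consumes): the Iwasawa parameter `y_σ(h)` of ANY block decomposition
`T_σ h̃_σ T_σ⁻¹ = [y b; 0 d]·κ` (BY VALUE) has `y yᴴ ⪰ c‖h‖⁻²` and `|det y|^{±1} ≤ c‖h‖^n`.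

THE MATHEMATICS (elementary; [BorelJacquet1979, §1.2, §4.1]: the height `‖g‖ = ∏_v max(|g_{ij}|_v, |g⁻¹_{ij}|_v)` dominates every archimedean entry of `g` and
`g⁻¹`; [MoeglinWaldspurger1995, I.2.2]).
* §1 ENTRY ALGEBRA over `ℂ` (any finite index type): `norm_mul_apply_le` (entries of a product), `norm_det_le_of_entry_le` (`|det X| ≤ m!·a^m`, Mathlib
  `Matrix.det_le`), `re_trace_eq_sum`, `norm_apply_le_re_trace_of_posDef` (entries of `X ≻ 0` are `≤ Re tr X`, via the 2×2 principal minors and ★ G7-A `posDef_two_entries`),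
  **`posSemidef_mul_conjTranspose_sub_smul`** — if `y z = 1` and the entries of `z` are `≤ R` then `y yᴴ − (m R)⁻²•1 ⪰ 0` (Cauchy–Schwarz on `x = zᴴ(yᴴx)`);
* §2 BLOCK-TRIANGULAR INVERSES: `inv_fromBlocks_zero₂₁_of_isUnit`, `toBlocks₁₁_inv_fromBlocks_zero₂₁`, `toBlocks₂₂_inv_fromBlocks_zero₂₁` (`A⁻¹`, `D⁻¹` are the
  diagonal blocks of `[A B; 0 D]⁻¹`, Mathlib `inv_fromBlocks_zero₂₁_of_isUnit_iff`);
* §3 **`norm_archAt_archPart_apply_le`** — at a complex place `w` fixed by `c`, every entry of the `w`-component `(h_∞)_w` of `h ∈ U(J)(𝔸_F)` and of its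
  inverse is `≤ ‖h‖` (★ `archHeight_le_adelicHeightGL`, the height being the sup of the archimedean entries of `h, h⁻¹` times local heights `≥ 1`).
HONEST LABEL.  Count-neutral helper; `HC_CM` is proved only modulo the 7 printed citations (2 remaining named inputs: hLiu418 = `stmt-HodgeConjecture-24832`,
h413 = `stmt-HodgeConjecture-24833`) until rung 0 closes.
-/

set_option autoImplicit false
set_option linter.dupNamespace false -- the mandated namespace repeats `HodgeConjecture.HodgeConjecture`

noncomputable section

open scoped BigOperators ComplexOrder Matrix
-- `Classical` is needed to see the Mathlib normed-ring instances on `mixedSpace E` (note H5 of `AdelicGLnGlue`)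
open scoped Classical
open Finset

namespace Summit.HodgeConjecture.HodgeConjecture.Cruxes.HLiu418.K2LiuArchBlockHeightBound

open Summit.HodgeConjecture.HodgeConjecture.Cruxes.HLiu418.K2LiuLatticeExpDecaySumBound (posDef_two_entries)

/-! ## §1 Entry algebra over `ℂ` -/

section Entry

variable {m : Type*} [Fintype m] [DecidableEq m]

omit [DecidableEq m] in
/-- entries of a product: `‖(XY)_{ij}‖ ≤ |m|·a·b` when the entries of `X`, `Y` are `≤ a`, `≤ b` (`a ≥ 0`). [folklore] -/
theorem norm_mul_apply_le {X Y : Matrix m m ℂ} {a b : ℝ} (ha : 0 ≤ a) (hX : ∀ i j, ‖X i j‖ ≤ a) (hY : ∀ i j, ‖Y i j‖ ≤ b) (i j : m) :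
    ‖(X * Y) i j‖ ≤ Fintype.card m * (a * b) := by
  rw [Matrix.mul_apply]
  calc ‖∑ k, X i k * Y k j‖ ≤ ∑ k, ‖X i k * Y k j‖ := norm_sum_le _ _
    _ ≤ ∑ _k : m, a * b := Finset.sum_le_sum fun k _ => by
        rw [norm_mul]; exact mul_le_mul (hX i k) (hY k j) (norm_nonneg _) ha
    _ = Fintype.card m * (a * b) := by rw [Finset.sum_const, Finset.card_univ, nsmul_eq_mul]

/-- `|det X| ≤ |m|! · a^{|m|}` when the entries of `X` are `≤ a` (Mathlib `Matrix.det_le` for the norm). [folklore] -/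
theorem norm_det_le_of_entry_le {X : Matrix m m ℂ} {a : ℝ} (hX : ∀ i j, ‖X i j‖ ≤ a) :
    ‖X.det‖ ≤ (Fintype.card m).factorial * a ^ Fintype.card m := by
  have h := Matrix.det_le (abv := IsAbsoluteValue.toAbsoluteValue (norm : ℂ → ℝ)) (A := X) (x := a) (fun i j => hX i j)
  rw [nsmul_eq_mul] at h
  exact h

omit [DecidableEq m] in
/-- the real part of the trace of a complex matrix is the sum of the real parts of the diagonal entries. [folklore] -/
theorem re_trace_eq_sum {X : Matrix m m ℂ} : (X.trace).re = ∑ k, (X k k).re := by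
  rw [Matrix.trace, Complex.re_sum]
  rfl

/-- **entries of a positive definite matrix are bounded by the (real part of the) trace**: `‖X_{ij}‖ ≤ Re tr X` (2×2 principal minors).
[folklore] -/
theorem norm_apply_le_re_trace_of_posDef {X : Matrix m m ℂ} (hX : X.PosDef) (i j : m) : ‖X i j‖ ≤ (X.trace).re := by
  have hdiag : ∀ k, 0 ≤ (X k k).re ∧ (X k k).im = 0 := fun k => by
    have h := Complex.nonneg_iff.1 (hX.posSemidef.diag_nonneg (i := k))
    exact ⟨h.1, h.2.symm⟩
  rw [re_trace_eq_sum]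
  by_cases hij : i = j
  · subst hij
    have hn : ‖X i i‖ = (X i i).re := by
      have e : X i i = ((X i i).re : ℂ) := Complex.ext (by simp) (by simp [(hdiag i).2])
      rw [e, Complex.norm_real, Real.norm_eq_abs, abs_of_nonneg (hdiag i).1, Complex.ofReal_re]
    rw [hn]
    exact Finset.single_le_sum (fun k _ => (hdiag k).1) (Finset.mem_univ i)
  · -- the principal 2×2 minor on `{i, j}`
    have hinj : Function.Injective ![i, j] := by
      intro a b hab
      fin_cases a <;> fin_cases b
      · rfl
      · exact absurd hab hij
      · exact absurd hab.symm hij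
      · rfl
    have hsub := hX.submatrix hinj
    have h2 := (posDef_two_entries hsub).2.2.2.2.1 0 1
    simp only [Matrix.submatrix_apply, Matrix.cons_val_zero, Matrix.cons_val_one] at h2
    refine h2.trans ?_
    calc (X i i).re + (X j j).re = ∑ k ∈ ({i, j} : Finset m), (X k k).re := by rw [Finset.sum_pair hij]
      _ ≤ ∑ k, (X k k).re := Finset.sum_le_sum_of_subset_of_nonneg (Finset.subset_univ _) fun k _ _ => (hdiag k).1

/-- **a quantitative positive-definiteness floor**: if `y z = 1` and every entry of `z` has norm `≤ R`, then
`y yᴴ − ((|m|·R)²)⁻¹ • 1 ⪰ 0` (for `x = zᴴ(yᴴx)`, Cauchy–Schwarz gives `‖x‖² ≤ (|m| R)² ‖yᴴ x‖²`). [folklore] -/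
theorem posSemidef_mul_conjTranspose_sub_smul {y z : Matrix m m ℂ} (hyz : y * z = 1) {R : ℝ} (hz : ∀ i j, ‖z i j‖ ≤ R) :
    (y * yᴴ - (((((Fintype.card m : ℝ) * R) ^ 2)⁻¹ : ℝ) : ℂ) • (1 : Matrix m m ℂ)).PosSemidef := by
  set c : ℝ := (Fintype.card m : ℝ) * R with hc
  set ε : ℝ := (c ^ 2)⁻¹ with hε
  have hε0 : 0 ≤ ε := by positivity
  have hεc : ε * c ^ 2 ≤ 1 := by rw [hε, inv_mul_eq_div]; exact div_self_le_one _
  -- `star v ⬝ᵥ v = Σ ‖vᵢ‖²` (the tree's `RayleighBottom.star_dotProduct_self_eq_sum`, inlined to keep the import light)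
  have hss : ∀ v : m → ℂ, star v ⬝ᵥ v = ((∑ i, ‖v i‖ ^ 2 : ℝ) : ℂ) := fun v => by
    rw [dotProduct, Complex.ofReal_sum]
    refine Finset.sum_congr rfl fun i _ => ?_
    rw [Pi.star_apply, Complex.star_def, Complex.conj_mul', Complex.ofReal_pow]
  refine Matrix.PosSemidef.of_dotProduct_mulVec_nonneg ?_ fun x => ?_
  · -- hermitian
    show (y * yᴴ - (ε : ℂ) • (1 : Matrix m m ℂ))ᴴ = y * yᴴ - (ε : ℂ) • (1 : Matrix m m ℂ)
    rw [Matrix.conjTranspose_sub, Matrix.conjTranspose_smul, Matrix.conjTranspose_one, Matrix.conjTranspose_mul,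
      Matrix.conjTranspose_conjTranspose, Complex.star_def, Complex.conj_ofReal]
  · -- the quadratic form
    set v : m → ℂ := yᴴ *ᵥ x with hv
    have hx : x = zᴴ *ᵥ v := by
      rw [hv, Matrix.mulVec_mulVec, ← Matrix.conjTranspose_mul, hyz, Matrix.conjTranspose_one, Matrix.one_mulVec]
    have hsv : star v = Matrix.vecMul (star x) y := by
      rw [hv, Matrix.star_mulVec, Matrix.conjTranspose_conjTranspose]
    have hq : star x ⬝ᵥ ((y * yᴴ - (ε : ℂ) • (1 : Matrix m m ℂ)) *ᵥ x) = star v ⬝ᵥ v - (ε : ℂ) * (star x ⬝ᵥ x) := by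
      rw [Matrix.sub_mulVec, Matrix.smul_mulVec, Matrix.one_mulVec, dotProduct_sub, dotProduct_smul, smul_eq_mul,
        ← Matrix.mulVec_mulVec, Matrix.dotProduct_mulVec, ← hsv]
    rw [hq, hss, hss, ← Complex.ofReal_mul, ← Complex.ofReal_sub, Complex.zero_le_real, sub_nonneg]
    -- the real inequality `ε Σ‖x_i‖² ≤ Σ‖v_j‖²`
    have hxi : ∀ i, ‖x i‖ ≤ R * ∑ j, ‖v j‖ := by
      intro i
      rw [hx]
      change ‖∑ j, zᴴ i j * v j‖ ≤ _
      calc ‖∑ j, zᴴ i j * v j‖ ≤ ∑ j, ‖zᴴ i j * v j‖ := norm_sum_le _ _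
        _ ≤ ∑ j, R * ‖v j‖ := Finset.sum_le_sum fun j _ => by
            rw [norm_mul, Matrix.conjTranspose_apply, norm_star]
            exact mul_le_mul_of_nonneg_right (hz j i) (norm_nonneg _)
        _ = R * ∑ j, ‖v j‖ := by rw [Finset.mul_sum]
    have hsq : ∀ i, ‖x i‖ ^ 2 ≤ R ^ 2 * ((Fintype.card m : ℝ) * ∑ j, ‖v j‖ ^ 2) := by
      intro i
      have h1 : ‖x i‖ ^ 2 ≤ (R * ∑ j, ‖v j‖) ^ 2 := pow_le_pow_left₀ (norm_nonneg _) (hxi i) 2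
      have h2 : (∑ j, ‖v j‖) ^ 2 ≤ (Fintype.card m : ℝ) * ∑ j, ‖v j‖ ^ 2 := by
        have := sq_sum_le_card_mul_sum_sq (s := (Finset.univ : Finset m)) (f := fun j => ‖v j‖)
        rwa [Finset.card_univ] at this
      calc ‖x i‖ ^ 2 ≤ (R * ∑ j, ‖v j‖) ^ 2 := h1
        _ = R ^ 2 * (∑ j, ‖v j‖) ^ 2 := by ring
        _ ≤ R ^ 2 * ((Fintype.card m : ℝ) * ∑ j, ‖v j‖ ^ 2) := mul_le_mul_of_nonneg_left h2 (sq_nonneg R)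
    have hsum : ∑ i, ‖x i‖ ^ 2 ≤ c ^ 2 * ∑ j, ‖v j‖ ^ 2 :=
      calc ∑ i, ‖x i‖ ^ 2 ≤ ∑ _i : m, R ^ 2 * ((Fintype.card m : ℝ) * ∑ j, ‖v j‖ ^ 2) := Finset.sum_le_sum fun i _ => hsq i
        _ = c ^ 2 * ∑ j, ‖v j‖ ^ 2 := by rw [Finset.sum_const, Finset.card_univ, nsmul_eq_mul, hc]; ring
    have hv0 : 0 ≤ ∑ j, ‖v j‖ ^ 2 := Finset.sum_nonneg fun j _ => sq_nonneg _
    calc ε * ∑ i, ‖x i‖ ^ 2 ≤ ε * (c ^ 2 * ∑ j, ‖v j‖ ^ 2) := mul_le_mul_of_nonneg_left hsum hε0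
      _ = (ε * c ^ 2) * ∑ j, ‖v j‖ ^ 2 := by ring
      _ ≤ 1 * ∑ j, ‖v j‖ ^ 2 := mul_le_mul_of_nonneg_right hεc hv0
      _ = ∑ j, ‖v j‖ ^ 2 := one_mul _

end Entry

/-! ## §2 Block-triangular inverses -/

section Block

variable {p q : Type*} [Fintype p] [Fintype q] [DecidableEq p] [DecidableEq q]

/-- the inverse of an invertible block-upper-triangular matrix. [folklore] -/
theorem inv_fromBlocks_zero₂₁_of_isUnit {A : Matrix p p ℂ} {B : Matrix p q ℂ} {D : Matrix q q ℂ} (h : IsUnit (Matrix.fromBlocks A B 0 D)) :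
    (Matrix.fromBlocks A B 0 D)⁻¹ = Matrix.fromBlocks A⁻¹ (-(A⁻¹ * B * D⁻¹)) 0 D⁻¹ := by
  have hAD := Matrix.isUnit_fromBlocks_zero₂₁.1 h
  exact Matrix.inv_fromBlocks_zero₂₁_of_isUnit_iff A B D ⟨fun _ => hAD.2, fun _ => hAD.1⟩

/-- **`A⁻¹` is the `(1,1)` block of `[A B; 0 D]⁻¹`** (invertible block-triangular matrix). [folklore] -/
theorem toBlocks₁₁_inv_fromBlocks_zero₂₁ {A : Matrix p p ℂ} {B : Matrix p q ℂ} {D : Matrix q q ℂ} (h : IsUnit (Matrix.fromBlocks A B 0 D)) :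
    ((Matrix.fromBlocks A B 0 D)⁻¹).toBlocks₁₁ = A⁻¹ := by
  rw [inv_fromBlocks_zero₂₁_of_isUnit h, Matrix.toBlocks_fromBlocks₁₁]

/-- **`D⁻¹` is the `(2,2)` block of `[A B; 0 D]⁻¹`**. [folklore] -/
theorem toBlocks₂₂_inv_fromBlocks_zero₂₁ {A : Matrix p p ℂ} {B : Matrix p q ℂ} {D : Matrix q q ℂ} (h : IsUnit (Matrix.fromBlocks A B 0 D)) :
    ((Matrix.fromBlocks A B 0 D)⁻¹).toBlocks₂₂ = D⁻¹ := by
  rw [inv_fromBlocks_zero₂₁_of_isUnit h, Matrix.toBlocks_fromBlocks₂₂]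

/-- entries of the diagonal blocks of `X` and of `X⁻¹` for `X = [A B; 0 D]` invertible: if all entries of `X` and `X⁻¹` are `≤ H`, then so are those of
`A, D, A⁻¹, D⁻¹`. [folklore] -/
theorem blocks_entry_le {A : Matrix p p ℂ} {B : Matrix p q ℂ} {D : Matrix q q ℂ} (h : IsUnit (Matrix.fromBlocks A B 0 D)) {H : ℝ}
    (hX : ∀ i j, ‖Matrix.fromBlocks A B 0 D i j‖ ≤ H) (hX' : ∀ i j, ‖(Matrix.fromBlocks A B 0 D)⁻¹ i j‖ ≤ H) :
    (∀ i j, ‖A i j‖ ≤ H) ∧ (∀ i j, ‖D i j‖ ≤ H) ∧ (∀ i j, ‖A⁻¹ i j‖ ≤ H) ∧ (∀ i j, ‖D⁻¹ i j‖ ≤ H) := by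
  refine ⟨fun i j => ?_, fun i j => ?_, fun i j => ?_, fun i j => ?_⟩
  · simpa only [Matrix.fromBlocks_apply₁₁] using hX (Sum.inl i) (Sum.inl j)
  · simpa only [Matrix.fromBlocks_apply₂₂] using hX (Sum.inr i) (Sum.inr j)
  · have e := toBlocks₁₁_inv_fromBlocks_zero₂₁ h
    have : A⁻¹ i j = (Matrix.fromBlocks A B 0 D)⁻¹ (Sum.inl i) (Sum.inl j) := by rw [← e]; rfl
    rw [this]; exact hX' _ _
  · have e := toBlocks₂₂_inv_fromBlocks_zero₂₁ h
    have : D⁻¹ i j = (Matrix.fromBlocks A B 0 D)⁻¹ (Sum.inr i) (Sum.inr j) := by rw [← e]; rfl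
    rw [this]; exact hX' _ _

end Block

/-! ## §3 Archimedean entries against the adelic height -/

section Arch

open NumberField NumberField.mixedEmbedding NumberField.InfinitePlace IsDedekindDomain
open Literature.NumberTheory.Automorphic Literature.NumberTheory.Automorphic.UnitaryGroup

variable (F E : Type) [Field F] [NumberField F] [Field E] [NumberField E] [Algebra F E] (c : E ≃ₐ[F] E) (N : ℕ) (J : Matrix (Fin N) (Fin N) E)

/-- an archimedean entry of `g ∈ GL_N(𝔸_E)` at a complex place is bounded by the archimedean height `H_∞(g)`, and so is the corresponding entry of
`g⁻¹`. [cite: BorelJacquet1979, §1.2 (property (i))] -/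
theorem norm_toMixed_apply_le_archHeight (g : GL (Fin N) (AdeleRing (𝓞 E) E)) (w : {w : InfinitePlace E // IsComplex w}) (i j : Fin N) :
    ‖(((GLn.toMixed N E g : GL (Fin N) (mixedSpace E)) : Matrix (Fin N) (Fin N) (mixedSpace E)) i j).2 w‖ ≤ GLn.archHeight N E g ∧
      ‖((((GLn.toMixed N E g)⁻¹ : GL (Fin N) (mixedSpace E)) : Matrix (Fin N) (Fin N) (mixedSpace E)) i j).2 w‖ ≤ GLn.archHeight N E g := by
  have hsup := Finset.le_sup (f := fun ij : Fin N × Fin N =>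
    ‖((GLn.toMixed N E g : GL (Fin N) (mixedSpace E)) : Matrix (Fin N) (Fin N) (mixedSpace E)) ij.1 ij.2‖₊ ⊔
      ‖((((GLn.toMixed N E g)⁻¹ : GL (Fin N) (mixedSpace E)) : Matrix (Fin N) (Fin N) (mixedSpace E)) ij.1 ij.2)‖₊) (Finset.mem_univ (i, j))
  have h1 : ‖((GLn.toMixed N E g : GL (Fin N) (mixedSpace E)) : Matrix (Fin N) (Fin N) (mixedSpace E)) i j‖ ≤ GLn.archHeight N E g := by
    have := le_sup_left.trans hsup
    exact_mod_cast this
  have h2 : ‖((((GLn.toMixed N E g)⁻¹ : GL (Fin N) (mixedSpace E)) : Matrix (Fin N) (Fin N) (mixedSpace E)) i j)‖ ≤ GLn.archHeight N E g := by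
    have := le_sup_right.trans hsup
    exact_mod_cast this
  exact ⟨((norm_le_pi_norm _ w).trans (norm_snd_le _)).trans h1, ((norm_le_pi_norm _ w).trans (norm_snd_le _)).trans h2⟩

/-- **ARCHIMEDEAN ENTRIES AGAINST THE ADELIC HEIGHT.**  For `h ∈ U(J)(𝔸_F)` and a complex place `w` fixed by `c ≠ 1`, every entry of the `w`-component
`(h_∞)_w = archAt w (archPart h) ∈ U(σ_w J)(ℂ)` and every entry of its inverse has norm `≤ ‖h‖` (`N ≥ 1`; the height is read on
`adelicVal h = ↑h`, definitionally the coercion to `GL_N(𝔸_E)`).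
[cite: BorelJacquet1979, §1.2 (property (i)), §4.1] [cite: MoeglinWaldspurger1995, I.2.2] -/
theorem norm_archAt_archPart_apply_le [NeZero N] (w : {w : InfinitePlace E // IsComplex w}) (hw : c • w.1 = w.1) (hc : c ≠ 1)
    (h : (adelicGroupData F E c N J).Adelic) (i j : Fin N) :
    ‖(((archAt F E c N J w hw hc (archPart F E c N J h) : archLocal E N J w) : GL (Fin N) ℂ) : Matrix (Fin N) (Fin N) ℂ) i j‖ ≤
        adelicHeightGL N E (adelicVal F E c N J h) ∧
      ‖((((archAt F E c N J w hw hc (archPart F E c N J h))⁻¹ : archLocal E N J w) : GL (Fin N) ℂ) : Matrix (Fin N) (Fin N) ℂ) i j‖ ≤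
        adelicHeightGL N E (adelicVal F E c N J h) := by
  have hH := archHeight_le_adelicHeightGL (n := N) (K := E) (adelicVal F E c N J h)
  obtain ⟨h1, h2⟩ := norm_toMixed_apply_le_archHeight E N (adelicVal F E c N J h) w i j
  constructor
  · rw [coe_archAt_apply, coe_archPart]
    exact h1.trans hH
  · rw [← map_inv, ← map_inv, coe_archAt_apply, coe_archPart, map_inv]
    exact h2.trans hH

end Arch

end Summit.HodgeConjecture.HodgeConjecture.Cruxes.HLiu418.K2LiuArchBlockHeightBound

end
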